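import Summits.QuantumFields.YangMills.Theorems.SwapVirialDeficitZeroModeGroupThreeLimit
import HarnessLib

/-!
# Exact zero-mode rung on the GROUP, three letters, Laplace form — VI: toward a POWER RATE `|β²Λ₃(β) − v₃| ≤ K·β^{−θ}` —
# the pointwise algebra of the rescaled exponent (free-hands support of ⟨stmt-QuantumFields-24197⟩; quantifies w2 g55's chain I–V)

Parts I–V (✓`ZeroModeGroup.tendsto_sq_mul_laplaceThree`) prove `β²Λ₃(β) → v₃` by dominated convergence of the rescaled integrand
`h_s = 𝟙{N_s(x)<1}𝟙{N_s(y)<1}e^{−E_s}` (`s = β⁻¹`) to `h_0` under the β-free Gaussian dominator `G = 𝟙𝟙e^{−gexp}`.  A sharp LAPLACE law with a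
power remainder (the currency of ✓`SharpSigma.swapGluedStiffness_of_sharpSwapLaplace`) needs a RATE; this file is the pointwise half:
§1 `1 − e^{−d} ≤ d^θ`, `|e^{−p} − e^{−q}| ≤ e^{−m}|p − q|^θ` (`p, q ≥ m`, `0 < θ ≤ 1`: the interpolation `min(1,d) ≤ d^θ` trading the
non-integrable weight `N_0⁻²` for `N_0^{−2θ}`); §2 ★ `abs_esc_sub_esc_zero_le`: inside the rescaled balls `|E_s − E_0| ≤ s·R`,
`R = 20(1 + |w|²)³/(N_0(x)²N_0(y)²)` (`|w|² = x_J²+x_K²+y_J²+y_K²`; four-term decomposition over real variables), and the floor `gexp ≤ E_s`;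
§3 ★★ `hsc_le_hsc_zero_add` / `hsc_zero_le_hsc_add`: `h_s ≤ h_0 + Δ₁`, `h_0 ≤ h_s + Δ₁ + Δ₂`, `Δ₁ = 𝟙𝟙·e^{−gexp}(sR)^θ`,
`Δ₂ =` (thin quadratic `x₀`/`y₀`-layers `{N_0 < 1 ≤ N_s}`)`·e^{−gexp}`.  Parts VII–IX integrate `Δ₁, Δ₂` in the pair frame and over the hub.
HONEST LABEL: finite-dimensional real analysis (plan-level zero-mode rung of a DRAFT line «sharp-sigma»); NOT the fixed-`L` sharp law, NOT ⟨24197⟩;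
the Yang–Mills mass gap is NOT proved; no summit is proved by a line.  Width seat ym-line-sfw-p2-w2 g56 (cell ym-idea-1, free hands; own crux
⟨22884⟩ blocked-on ⟨19935⟩), `--supports stmt-QuantumFields-24197`.  Standard axioms, 0 `sorry`.  References: [cite: GonzalezarroyoAltes1988];
[cite: Vanbaal2001]; [folklore].
-/

set_option autoImplicit false

noncomputable section

open MeasureTheory Quaternion Set Filter Topology
open scoped Quaternion ENNReal
open Literature.MathematicalPhysics.QuantumLattice
open Summit.QuantumFields.YangMills.Theorems.SwapTwistDeficit.ToronLog

attribute [local instance] Literature.Analysis.FluidPDE.Tao2016.quatMeasurableSpace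
  Literature.Analysis.FluidPDE.Tao2016.quatBorelSpace
  Literature.MathematicalPhysics.QuantumLattice.secondCountableTopology_su2

namespace Summit.QuantumFields.YangMills.Theorems.SwapVirialDeficit.ZeroModeGroup

/-! ## §1 Two real-variable facts -/

/-- `1 − e^{−d} ≤ d^θ` for `d ≥ 0`, `0 < θ ≤ 1` (`min(1,d) ≤ d^θ`). [folklore] -/
theorem one_sub_exp_neg_le_rpow {d θ : ℝ} (hd : 0 ≤ d) (hθ : 0 < θ) (hθ1 : θ ≤ 1) : 1 - Real.exp (-d) ≤ d ^ θ := by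
  rcases le_or_gt d 1 with h | h
  · calc 1 - Real.exp (-d) ≤ d := by linarith [Real.one_sub_le_exp_neg d]
      _ ≤ d ^ θ := Real.self_le_rpow_of_le_one hd h hθ1
  · calc 1 - Real.exp (-d) ≤ 1 := by linarith [Real.exp_pos (-d)]
      _ ≤ d ^ θ := Real.one_le_rpow h.le hθ.le

/-- `|e^{−p} − e^{−q}| ≤ e^{−m}·|p − q|^θ` when `m ≤ p`, `m ≤ q`, `0 < θ ≤ 1`. [folklore] -/
theorem abs_exp_neg_sub_exp_neg_le {p q m θ : ℝ} (hp : m ≤ p) (hq : m ≤ q) (hθ : 0 < θ) (hθ1 : θ ≤ 1) :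
    |Real.exp (-p) - Real.exp (-q)| ≤ Real.exp (-m) * |p - q| ^ θ := by
  -- the ordered case
  have key : ∀ p q : ℝ, m ≤ p → p ≤ q → Real.exp (-p) - Real.exp (-q) ≤ Real.exp (-m) * |p - q| ^ θ := by
    intro p q hp hpq
    have h1 : Real.exp (-p) - Real.exp (-q) = Real.exp (-p) * (1 - Real.exp (-(q - p))) := by
      rw [mul_sub, mul_one, ← Real.exp_add]; ring_nf
    have h2 : 1 - Real.exp (-(q - p)) ≤ (q - p) ^ θ := one_sub_exp_neg_le_rpow (by linarith) hθ hθ1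
    have h3 : |p - q| = q - p := by rw [abs_sub_comm]; exact abs_of_nonneg (by linarith)
    rw [h1, h3]
    have h4 : Real.exp (-p) ≤ Real.exp (-m) := Real.exp_le_exp.2 (by linarith)
    have h5 : 0 ≤ (q - p) ^ θ := Real.rpow_nonneg (by linarith) _
    calc Real.exp (-p) * (1 - Real.exp (-(q - p))) ≤ Real.exp (-p) * (q - p) ^ θ :=
          mul_le_mul_of_nonneg_left h2 (Real.exp_pos _).le
      _ ≤ Real.exp (-m) * (q - p) ^ θ := mul_le_mul_of_nonneg_right h4 h5
  rcases le_or_gt p q with h | h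
  · rw [abs_of_nonneg (by linarith [Real.exp_le_exp.2 (neg_le_neg h)])]
    exact key p q hp h
  · rw [abs_of_nonpos (by linarith [Real.exp_le_exp.2 (neg_le_neg h.le)]), neg_sub, abs_sub_comm]
    exact key q p hq h.le

/-- Reciprocal differences: `0 < a ≤ a'` gives `0 ≤ 1/a − 1/a' ≤ (a' − a)/a²`. [folklore] -/
theorem inv_sub_inv_le_of_le {a a' : ℝ} (ha : 0 < a) (h : a ≤ a') : 0 ≤ 1 / a - 1 / a' ∧ 1 / a - 1 / a' ≤ (a' - a) / a ^ 2 := by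
  have ha' : 0 < a' := lt_of_lt_of_le ha h
  have e : 1 / a - 1 / a' = (a' - a) / (a * a') := by field_simp
  rw [e]
  refine ⟨div_nonneg (by linarith) (by positivity), ?_⟩
  exact div_le_div_of_nonneg_left (by linarith) (by positivity) (by rw [sq]; exact mul_le_mul_of_nonneg_left h ha.le)

/-! ## §2 The exponent: the Gaussian floor and the `s`-Lipschitz bound -/

/-- The exponent of the β-free dominator `G`: `gexp r x y = 4[r²(x_J²+x_K²+y_J²+y_K²) + (x_Ky_I − x_Iy_K)² + (x_Iy_J − x_Jy_I)²]`
(so that `G = 𝟙𝟙·e^{−gexp}`, ✓`dominator_def`). [folklore] -/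
def gexp (r : ℝ) (x y : ℍ) : ℝ :=
  4 * (r ^ 2 * (x.imJ ^ 2 + x.imK ^ 2 + y.imJ ^ 2 + y.imK ^ 2) + ((x.imK * y.imI - x.imI * y.imK) ^ 2 + (x.imI * y.imJ - x.imJ * y.imI) ^ 2))

/-- Unfolding `gexp`. [folklore] -/
theorem gexp_def (r : ℝ) (x y : ℍ) : gexp r x y =
    4 * (r ^ 2 * (x.imJ ^ 2 + x.imK ^ 2 + y.imJ ^ 2 + y.imK ^ 2) + ((x.imK * y.imI - x.imI * y.imK) ^ 2 + (x.imI * y.imJ - x.imJ * y.imI) ^ 2)) := rfl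

/-- `gexp ≥ 0`. [folklore] -/
theorem gexp_nonneg (r : ℝ) (x y : ℍ) : 0 ≤ gexp r x y := by rw [gexp_def]; positivity

/-- The dominator in terms of `gexp`. [folklore] -/
theorem dominator_eq_gexp (r : ℝ) (x y : ℍ) : dominator r x y =
    ({x : ℍ | x.re ^ 2 + x.imI ^ 2 < 1}.indicator (fun _ => (1 : ℝ≥0∞)) x) * ({y : ℍ | y.re ^ 2 + y.imI ^ 2 < 1}.indicator (fun _ => (1 : ℝ≥0∞)) y) *
      ENNReal.ofReal (Real.exp (-(gexp r x y))) := by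
  rw [dominator_def, gexp_def]

/-- The rate weight `R(x,y) = 20(1 + x_J²+x_K²+y_J²+y_K²)³/((x₀²+x_I²)²(y₀²+y_I²)²)`. [folklore] -/
def rateR (x y : ℍ) : ℝ :=
  20 * (1 + (x.imJ ^ 2 + x.imK ^ 2 + y.imJ ^ 2 + y.imK ^ 2)) ^ 3 / ((x.re ^ 2 + x.imI ^ 2) ^ 2 * (y.re ^ 2 + y.imI ^ 2) ^ 2)

/-- Unfolding `rateR`. [folklore] -/
theorem rateR_def (x y : ℍ) : rateR x y =
    20 * (1 + (x.imJ ^ 2 + x.imK ^ 2 + y.imJ ^ 2 + y.imK ^ 2)) ^ 3 / ((x.re ^ 2 + x.imI ^ 2) ^ 2 * (y.re ^ 2 + y.imI ^ 2) ^ 2) := rfl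

/-- `R ≥ 0`. [folklore] -/
theorem rateR_nonneg (x y : ℍ) : 0 ≤ rateR x y := by rw [rateR_def]; positivity

/-- ★ **The Gaussian floor**: for `s ≥ 0`, `0 < A ≤ 1` and letters with `0 < N_s ≤ 1`, `gexp ≤ E_s`. [folklore] -/
theorem gexp_le_esc {s A r : ℝ} (hs : 0 ≤ s) (hA0 : 0 < A) (hA1 : A ≤ 1) {x y : ℍ}
    (hx0 : 0 < nsc s x) (hx1 : nsc s x ≤ 1) (hy0 : 0 < nsc s y) (hy1 : nsc s y ≤ 1) : gexp r x y ≤ esc s A r x y := by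
  rw [gexp_def, esc_def]
  -- term 1
  have h1 : 4 * ((x.imK * y.imI - x.imI * y.imK) ^ 2 + (x.imI * y.imJ - x.imJ * y.imI) ^ 2) ≤
      4 * ((x.imK * y.imI - x.imI * y.imK) ^ 2 + (x.imI * y.imJ - x.imJ * y.imI) ^ 2 + s * (x.imJ * y.imK - x.imK * y.imJ) ^ 2) /
        (nsc s x * nsc s y) := by
    rw [le_div_iff₀ (mul_pos hx0 hy0)]
    have hprod : nsc s x * nsc s y ≤ 1 := by nlinarith
    have hc : 0 ≤ 4 * ((x.imK * y.imI - x.imI * y.imK) ^ 2 + (x.imI * y.imJ - x.imJ * y.imI) ^ 2) := by positivity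
    have hc3 : 0 ≤ 4 * (s * (x.imJ * y.imK - x.imK * y.imJ) ^ 2) := by positivity
    nlinarith
  have h2 : 4 * (r ^ 2 * (x.imJ ^ 2 + x.imK ^ 2)) ≤ 4 * (r ^ 2 * (x.imJ ^ 2 + x.imK ^ 2)) / (nsc s x * A) := by
    rw [le_div_iff₀ (mul_pos hx0 hA0)]
    have hprod : nsc s x * A ≤ 1 := by nlinarith
    have hc : 0 ≤ 4 * (r ^ 2 * (x.imJ ^ 2 + x.imK ^ 2)) := by positivity
    nlinarith
  have h3 : 4 * (r ^ 2 * (y.imJ ^ 2 + y.imK ^ 2)) ≤ 4 * (r ^ 2 * (y.imJ ^ 2 + y.imK ^ 2)) / (nsc s y * A) := by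
    rw [le_div_iff₀ (mul_pos hy0 hA0)]
    have hprod : nsc s y * A ≤ 1 := by nlinarith
    have hc : 0 ≤ 4 * (r ^ 2 * (y.imJ ^ 2 + y.imK ^ 2)) := by positivity
    nlinarith
  linarith

/-- Core estimate, term 1: the cross-term quotient moves by `≤ 16 s (u+v)(u+v+uv)/(a²b²)`. [folklore] -/
theorem esc_core_T1 {s a b u v c12 : ℝ} (hs0 : 0 < s) (hs1 : s ≤ 1) (ha0 : 0 < a) (hb0 : 0 < b) (ha1 : a < 1) (hb1 : b < 1)
    (hu : 0 ≤ u) (hv : 0 ≤ v) (hc12 : 0 ≤ c12) (hc12le : c12 ≤ 4 * (u + v)) :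
    0 ≤ 4 * c12 * (1 / (a * b) - 1 / ((a + s * u) * (b + s * v))) ∧
      4 * c12 * (1 / (a * b) - 1 / ((a + s * u) * (b + s * v))) ≤ 16 * s * ((u + v) * ((u + v) + u * v)) / (a ^ 2 * b ^ 2) := by
  have has : a ≤ a + s * u := by nlinarith
  have hbs : b ≤ b + s * v := by nlinarith
  obtain ⟨hT1a, hT1b⟩ := inv_sub_inv_le_of_le (mul_pos ha0 hb0) (mul_le_mul has hbs hb0.le (by linarith) :
    a * b ≤ (a + s * u) * (b + s * v))
  refine ⟨mul_nonneg (by positivity) hT1a, ?_⟩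
  have hgap : (a + s * u) * (b + s * v) - a * b ≤ s * ((u + v) + u * v) := by
    have e : (a + s * u) * (b + s * v) - a * b = s * (u * b + a * v) + s ^ 2 * (u * v) := by ring
    rw [e]
    have h1 : u * b + a * v ≤ u + v := by nlinarith
    have hs2 : s ^ 2 ≤ s := by nlinarith
    have h2 : s ^ 2 * (u * v) ≤ s * (u * v) := mul_le_mul_of_nonneg_right hs2 (mul_nonneg hu hv)
    nlinarith [mul_le_mul_of_nonneg_left h1 hs0.le]
  have step1 : 1 / (a * b) - 1 / ((a + s * u) * (b + s * v)) ≤ s * ((u + v) + u * v) / (a * b) ^ 2 :=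
    hT1b.trans (div_le_div_of_nonneg_right hgap (by positivity))
  calc 4 * c12 * (1 / (a * b) - 1 / ((a + s * u) * (b + s * v)))
      ≤ (16 * (u + v)) * (s * ((u + v) + u * v) / (a * b) ^ 2) :=
        mul_le_mul (by linarith) step1 hT1a (by positivity)
    _ = 16 * s * ((u + v) * ((u + v) + u * v)) / (a ^ 2 * b ^ 2) := by ring

/-- Core estimate, term 2: `0 ≤ 4 s c3/(a_s b_s) ≤ 4 s u v/(a² b²)`. [folklore] -/
theorem esc_core_T2 {s a b u v c3 : ℝ} (hs0 : 0 < s) (ha0 : 0 < a) (hb0 : 0 < b) (ha1 : a < 1) (hb1 : b < 1)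
    (hu : 0 ≤ u) (hv : 0 ≤ v) (hc3 : 0 ≤ c3) (hc3le : c3 ≤ u * v) :
    0 ≤ 4 * (s * c3) / ((a + s * u) * (b + s * v)) ∧ 4 * (s * c3) / ((a + s * u) * (b + s * v)) ≤ 4 * s * (u * v) / (a ^ 2 * b ^ 2) := by
  have has : a ≤ a + s * u := by nlinarith
  have hbs : b ≤ b + s * v := by nlinarith
  refine ⟨by positivity, ?_⟩
  have hab2 : a ^ 2 * b ^ 2 ≤ (a + s * u) * (b + s * v) := by
    have h1 : a ^ 2 ≤ a := by nlinarith
    have h2 : b ^ 2 ≤ b := by nlinarith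
    calc a ^ 2 * b ^ 2 ≤ a * b := mul_le_mul h1 h2 (by positivity) ha0.le
      _ ≤ (a + s * u) * (b + s * v) := mul_le_mul has hbs hb0.le (by linarith)
  calc 4 * (s * c3) / ((a + s * u) * (b + s * v)) ≤ 4 * (s * c3) / (a ^ 2 * b ^ 2) :=
        div_le_div_of_nonneg_left (by positivity) (by positivity) hab2
    _ ≤ 4 * s * (u * v) / (a ^ 2 * b ^ 2) := by
        refine div_le_div_of_nonneg_right ?_ (by positivity)
        nlinarith [mul_le_mul_of_nonneg_left hc3le hs0.le]

/-- Core estimate, term 3 (and 4 by symmetry): `0 ≤ (4ρ²u)(1/a − 1/a_s) ≤ 4 s u²/(a² b²)` for `ρ² ≤ 1`, `b ≤ 1`. [folklore] -/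
theorem esc_core_T3 {s a b u ρ2 : ℝ} (hs0 : 0 < s) (ha0 : 0 < a) (hb0 : 0 < b) (hb1 : b < 1) (hu : 0 ≤ u) (hρ0 : 0 ≤ ρ2)
    (hρ : ρ2 ≤ 1) :
    0 ≤ 4 * (ρ2 * u) * (1 / a - 1 / (a + s * u)) ∧ 4 * (ρ2 * u) * (1 / a - 1 / (a + s * u)) ≤ 4 * s * u ^ 2 / (a ^ 2 * b ^ 2) := by
  have has : a ≤ a + s * u := by nlinarith
  obtain ⟨hT3a, hT3b⟩ := inv_sub_inv_le_of_le ha0 has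
  refine ⟨mul_nonneg (by positivity) hT3a, ?_⟩
  have hb2 : b ^ 2 ≤ 1 := by nlinarith
  have step : 1 / a - 1 / (a + s * u) ≤ s * u / a ^ 2 := hT3b.trans (by rw [show a + s * u - a = s * u by ring])
  have hρu : ρ2 * u ≤ u := by have := mul_le_mul_of_nonneg_right hρ hu; linarith
  calc 4 * (ρ2 * u) * (1 / a - 1 / (a + s * u)) ≤ (4 * u) * (s * u / a ^ 2) :=
        mul_le_mul (by linarith) step hT3a (by positivity)
    _ = 4 * s * u ^ 2 / a ^ 2 := by ring
    _ ≤ 4 * s * u ^ 2 / (a ^ 2 * b ^ 2) :=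
        div_le_div_of_nonneg_left (by positivity) (by positivity)
          (by have := mul_le_mul_of_nonneg_left hb2 (sq_nonneg a); linarith)

/-- Core estimate, the decomposition `E_0 − E_s = T1 − T2 + T3 + T4`. [folklore] -/
theorem esc_core_dec {s A r2 a b u v c12 c3 : ℝ} (hs0 : 0 < s) (hA0 : 0 < A) (ha0 : 0 < a) (hb0 : 0 < b) (hu : 0 ≤ u) (hv : 0 ≤ v) :
    (4 * c12 / (a * b) + 4 * (r2 * u) / (a * A) + 4 * (r2 * v) / (b * A)) -
      (4 * (c12 + s * c3) / ((a + s * u) * (b + s * v)) + 4 * (r2 * u) / ((a + s * u) * A) + 4 * (r2 * v) / ((b + s * v) * A)) =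
      4 * c12 * (1 / (a * b) - 1 / ((a + s * u) * (b + s * v))) - 4 * (s * c3) / ((a + s * u) * (b + s * v)) +
        4 * (r2 / A * u) * (1 / a - 1 / (a + s * u)) + 4 * (r2 / A * v) * (1 / b - 1 / (b + s * v)) := by
  have hane : a ≠ 0 := ha0.ne'; have hbne : b ≠ 0 := hb0.ne'; have hAne : A ≠ 0 := hA0.ne'
  have hasne : a + s * u ≠ 0 := by positivity
  have hbsne : b + s * v ≠ 0 := by positivity
  field_simp; ring

/-- Core estimate, the polynomial majorant: `16σ(σ+uv) + 4uv + 4u² + 4v² ≤ 20(1+σ)³`, `σ = u + v`. [folklore] -/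
theorem esc_core_poly {u v : ℝ} (hu : 0 ≤ u) (hv : 0 ≤ v) :
    16 * ((u + v) * ((u + v) + u * v)) + 4 * (u * v) + 4 * u ^ 2 + 4 * v ^ 2 ≤ 20 * (1 + (u + v)) ^ 3 := by
  have key : 20 * (1 + (u + v)) ^ 3 - (16 * ((u + v) * ((u + v) + u * v)) + 4 * (u * v) + 4 * u ^ 2 + 4 * v ^ 2) =
      20 + 60 * u + 60 * v + 40 * u ^ 2 + 84 * (u * v) + 40 * v ^ 2 + 20 * u ^ 3 + 44 * (u ^ 2 * v) + 44 * (u * v ^ 2) +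
        20 * v ^ 3 := by ring
  have hnn : 0 ≤ 20 + 60 * u + 60 * v + 40 * u ^ 2 + 84 * (u * v) + 40 * v ^ 2 + 20 * u ^ 3 + 44 * (u ^ 2 * v) + 44 * (u * v ^ 2) +
        20 * v ^ 3 := by positivity
  linarith

/-- The core real-variable estimate behind ★`abs_esc_sub_esc_zero_le`: with `a, b` the longitudinal squared norms, `u, v` the transverse
ones, `c12 ≤ 4(u+v)`, `c3 ≤ uv` the cross terms and `r2/A ≤ 1`, the rescaled exponent moves by at most `s·20(1+u+v)³/(a²b²)`
between `s` and `0`. [folklore] -/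
theorem esc_core_bound {s A r2 a b u v c12 c3 σ : ℝ} (hs0 : 0 < s) (hs1 : s ≤ 1) (hA0 : 0 < A) (hr2 : 0 ≤ r2) (hρ : r2 / A ≤ 1)
    (ha0 : 0 < a) (hb0 : 0 < b) (has1 : a + s * u < 1) (hbs1 : b + s * v < 1) (hu : 0 ≤ u) (hv : 0 ≤ v) (hc12 : 0 ≤ c12)
    (hc3 : 0 ≤ c3) (hc12le : c12 ≤ 4 * (u + v)) (hc3le : c3 ≤ u * v) (hσ : σ = u + v) :
    |(4 * (c12 + s * c3) / ((a + s * u) * (b + s * v)) + 4 * (r2 * u) / ((a + s * u) * A) + 4 * (r2 * v) / ((b + s * v) * A)) -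
        (4 * (c12 + 0 * c3) / ((a + 0 * u) * (b + 0 * v)) + 4 * (r2 * u) / ((a + 0 * u) * A) + 4 * (r2 * v) / ((b + 0 * v) * A))| ≤
      s * (20 * (1 + σ) ^ 3 / (a ^ 2 * b ^ 2)) := by
  subst hσ
  simp only [zero_mul, add_zero]
  have ha1 : a < 1 := by nlinarith
  have hb1 : b < 1 := by nlinarith
  obtain ⟨h1a, h1b⟩ := esc_core_T1 (c12 := c12) hs0 hs1 ha0 hb0 ha1 hb1 hu hv hc12 hc12le
  obtain ⟨h2a, h2b⟩ := esc_core_T2 (c3 := c3) hs0 ha0 hb0 ha1 hb1 hu hv hc3 hc3le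
  obtain ⟨h3a, h3b⟩ := esc_core_T3 (ρ2 := r2 / A) hs0 ha0 hb0 hb1 hu (by positivity) hρ
  obtain ⟨h4a, h4b⟩ := esc_core_T3 (ρ2 := r2 / A) hs0 hb0 ha0 ha1 hv (by positivity) hρ
  rw [mul_comm (b ^ 2) (a ^ 2)] at h4b
  have hsum : 16 * s * ((u + v) * ((u + v) + u * v)) / (a ^ 2 * b ^ 2) + 4 * s * (u * v) / (a ^ 2 * b ^ 2) +
      4 * s * u ^ 2 / (a ^ 2 * b ^ 2) + 4 * s * v ^ 2 / (a ^ 2 * b ^ 2) ≤ s * (20 * (1 + (u + v)) ^ 3 / (a ^ 2 * b ^ 2)) := by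
    rw [← add_div, ← add_div, ← add_div, mul_div_assoc']
    refine div_le_div_of_nonneg_right ?_ (by positivity)
    have e : 16 * s * ((u + v) * ((u + v) + u * v)) + 4 * s * (u * v) + 4 * s * u ^ 2 + 4 * s * v ^ 2 =
        s * (16 * ((u + v) * ((u + v) + u * v)) + 4 * (u * v) + 4 * u ^ 2 + 4 * v ^ 2) := by ring
    rw [e]
    exact mul_le_mul_of_nonneg_left (esc_core_poly hu hv) hs0.le
  rw [abs_sub_comm, abs_le, esc_core_dec hs0 hA0 ha0 hb0 hu hv]
  exact ⟨by linarith, by linarith⟩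

/-- ★ **The `s`-Lipschitz bound**: for `0 < s ≤ 1`, `0 < A ≤ 1`, `r² ≤ A` and letters inside the rescaled balls (`N_s < 1`) with `N_0 > 0`:
`|E_s − E_0| ≤ s·R(x,y)`. [folklore] -/
theorem abs_esc_sub_esc_zero_le {s A r : ℝ} (hs0 : 0 < s) (hs1 : s ≤ 1) (hA0 : 0 < A) (hrA : r ^ 2 ≤ A) {x y : ℍ}
    (hxs : nsc s x < 1) (hys : nsc s y < 1) (hx0 : 0 < x.re ^ 2 + x.imI ^ 2) (hy0 : 0 < y.re ^ 2 + y.imI ^ 2) :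
    |esc s A r x y - esc 0 A r x y| ≤ s * rateR x y := by
  have hxs' : x.re ^ 2 + x.imI ^ 2 + s * (x.imJ ^ 2 + x.imK ^ 2) < 1 := by rwa [nsc_def] at hxs
  have hys' : y.re ^ 2 + y.imI ^ 2 + s * (y.imJ ^ 2 + y.imK ^ 2) < 1 := by rwa [nsc_def] at hys
  have hu : 0 ≤ x.imJ ^ 2 + x.imK ^ 2 := by positivity
  have hv : 0 ≤ y.imJ ^ 2 + y.imK ^ 2 := by positivity
  have hxI : x.imI ^ 2 ≤ 1 := by nlinarith [sq_nonneg x.re]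
  have hyI : y.imI ^ 2 ≤ 1 := by nlinarith [sq_nonneg y.re]
  have hc12le : (x.imK * y.imI - x.imI * y.imK) ^ 2 + (x.imI * y.imJ - x.imJ * y.imI) ^ 2 ≤
      4 * ((x.imJ ^ 2 + x.imK ^ 2) + (y.imJ ^ 2 + y.imK ^ 2)) := by
    have e1 : (x.imK * y.imI - x.imI * y.imK) ^ 2 ≤ 2 * (x.imK ^ 2 * y.imI ^ 2 + x.imI ^ 2 * y.imK ^ 2) := by
      nlinarith [sq_nonneg (x.imK * y.imI + x.imI * y.imK)]
    have e2 : (x.imI * y.imJ - x.imJ * y.imI) ^ 2 ≤ 2 * (x.imI ^ 2 * y.imJ ^ 2 + x.imJ ^ 2 * y.imI ^ 2) := by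
      nlinarith [sq_nonneg (x.imI * y.imJ + x.imJ * y.imI)]
    have f1 : x.imK ^ 2 * y.imI ^ 2 ≤ x.imK ^ 2 * 1 := mul_le_mul_of_nonneg_left hyI (sq_nonneg _)
    have f2 : x.imI ^ 2 * y.imK ^ 2 ≤ 1 * y.imK ^ 2 := mul_le_mul_of_nonneg_right hxI (sq_nonneg _)
    have f3 : x.imI ^ 2 * y.imJ ^ 2 ≤ 1 * y.imJ ^ 2 := mul_le_mul_of_nonneg_right hxI (sq_nonneg _)
    have f4 : x.imJ ^ 2 * y.imI ^ 2 ≤ x.imJ ^ 2 * 1 := mul_le_mul_of_nonneg_left hyI (sq_nonneg _)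
    nlinarith [sq_nonneg x.imJ, sq_nonneg x.imK, sq_nonneg y.imJ, sq_nonneg y.imK]
  have hc3le : (x.imJ * y.imK - x.imK * y.imJ) ^ 2 ≤ (x.imJ ^ 2 + x.imK ^ 2) * (y.imJ ^ 2 + y.imK ^ 2) := by
    nlinarith [sq_nonneg (x.imJ * y.imJ + x.imK * y.imK)]
  have hρ : r ^ 2 / A ≤ 1 := by rw [div_le_one hA0]; exact hrA
  have h := esc_core_bound (c12 := (x.imK * y.imI - x.imI * y.imK) ^ 2 + (x.imI * y.imJ - x.imJ * y.imI) ^ 2)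
    (c3 := (x.imJ * y.imK - x.imK * y.imJ) ^ 2) (σ := x.imJ ^ 2 + x.imK ^ 2 + y.imJ ^ 2 + y.imK ^ 2)
    hs0 hs1 hA0 (sq_nonneg r) hρ hx0 hy0 hxs' hys' hu hv (by positivity) (by positivity) hc12le hc3le (by ring)
  rw [esc_def, esc_def, nsc_def, nsc_def, nsc_def, nsc_def, rateR_def]
  exact h

/-! ## §3 The two one-sided pointwise bounds -/

/-- The thin quadratic layer of the ball indicators: `{x | N_0(x) < 1 ≤ N_s(x)}` = `{1 − x_I² − s(x_J²+x_K²) ≤ x₀² < 1 − x_I²}`. [folklore] -/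
def layer (s : ℝ) : Set ℍ := {x : ℍ | x.re ^ 2 + x.imI ^ 2 < 1 ∧ 1 ≤ x.re ^ 2 + x.imI ^ 2 + s * (x.imJ ^ 2 + x.imK ^ 2)}

/-- Membership in `layer`. [folklore] -/
theorem mem_layer (s : ℝ) (x : ℍ) : x ∈ layer s ↔ x.re ^ 2 + x.imI ^ 2 < 1 ∧ 1 ≤ x.re ^ 2 + x.imI ^ 2 + s * (x.imJ ^ 2 + x.imK ^ 2) :=
  Iff.rfl

/-- The first rate term `Δ₁ = 𝟙{N_0(x)<1}𝟙{N_0(y)<1}·e^{−gexp}·(s·R)^θ`. [folklore] -/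
def rateΔ₁ (s θ r : ℝ) (x y : ℍ) : ℝ≥0∞ :=
  ({x : ℍ | x.re ^ 2 + x.imI ^ 2 < 1}.indicator (fun _ => (1 : ℝ≥0∞)) x) * ({y : ℍ | y.re ^ 2 + y.imI ^ 2 < 1}.indicator (fun _ => (1 : ℝ≥0∞)) y) *
    ENNReal.ofReal (Real.exp (-(gexp r x y)) * (s * rateR x y) ^ θ)

/-- The second rate term `Δ₂ = (𝟙_{layer}(x)𝟙{N_0(y)<1} + 𝟙{N_0(x)<1}𝟙_{layer}(y))·e^{−gexp}`. [folklore] -/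
def rateΔ₂ (s r : ℝ) (x y : ℍ) : ℝ≥0∞ :=
  (((layer s).indicator (fun _ => (1 : ℝ≥0∞)) x) * ({y : ℍ | y.re ^ 2 + y.imI ^ 2 < 1}.indicator (fun _ => (1 : ℝ≥0∞)) y) +
    ({x : ℍ | x.re ^ 2 + x.imI ^ 2 < 1}.indicator (fun _ => (1 : ℝ≥0∞)) x) * ((layer s).indicator (fun _ => (1 : ℝ≥0∞)) y)) *
    ENNReal.ofReal (Real.exp (-(gexp r x y)))

/-- Unfolding `rateΔ₁`. [folklore] -/
theorem rateΔ₁_def (s θ r : ℝ) (x y : ℍ) : rateΔ₁ s θ r x y =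
    ({x : ℍ | x.re ^ 2 + x.imI ^ 2 < 1}.indicator (fun _ => (1 : ℝ≥0∞)) x) * ({y : ℍ | y.re ^ 2 + y.imI ^ 2 < 1}.indicator (fun _ => (1 : ℝ≥0∞)) y) *
      ENNReal.ofReal (Real.exp (-(gexp r x y)) * (s * rateR x y) ^ θ) := rfl

/-- Unfolding `rateΔ₂`. [folklore] -/
theorem rateΔ₂_def (s r : ℝ) (x y : ℍ) : rateΔ₂ s r x y =
    (((layer s).indicator (fun _ => (1 : ℝ≥0∞)) x) * ({y : ℍ | y.re ^ 2 + y.imI ^ 2 < 1}.indicator (fun _ => (1 : ℝ≥0∞)) y) +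
      ({x : ℍ | x.re ^ 2 + x.imI ^ 2 < 1}.indicator (fun _ => (1 : ℝ≥0∞)) x) * ((layer s).indicator (fun _ => (1 : ℝ≥0∞)) y)) *
      ENNReal.ofReal (Real.exp (-(gexp r x y))) := rfl

/-- Inside both rescaled balls the two exponentials differ by at most `e^{−gexp}(sR)^θ`. [folklore] -/
theorem abs_exp_esc_sub_le {s A r θ : ℝ} (hs0 : 0 < s) (hs1 : s ≤ 1) (hA0 : 0 < A) (hA1 : A ≤ 1) (hrA : r ^ 2 ≤ A)
    (hθ : 0 < θ) (hθ1 : θ ≤ 1) {x y : ℍ} (hxs : nsc s x < 1) (hys : nsc s y < 1) (hx0 : 0 < x.re ^ 2 + x.imI ^ 2)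
    (hy0 : 0 < y.re ^ 2 + y.imI ^ 2) :
    |Real.exp (-(esc s A r x y)) - Real.exp (-(esc 0 A r x y))| ≤ Real.exp (-(gexp r x y)) * (s * rateR x y) ^ θ := by
  have hxs0 : 0 < nsc s x := lt_of_lt_of_le (by rwa [nsc_zero]) (nsc_mono hs0.le x)
  have hys0 : 0 < nsc s y := lt_of_lt_of_le (by rwa [nsc_zero]) (nsc_mono hs0.le y)
  have hx01 : nsc 0 x ≤ 1 := (nsc_mono hs0.le x).trans hxs.le; have hy01 : nsc 0 y ≤ 1 := (nsc_mono hs0.le y).trans hys.le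
  have hms : gexp r x y ≤ esc s A r x y := gexp_le_esc hs0.le hA0 hA1 hxs0 hxs.le hys0 hys.le
  have hm0 : gexp r x y ≤ esc 0 A r x y := gexp_le_esc le_rfl hA0 hA1 (by rwa [nsc_zero]) hx01 (by rwa [nsc_zero]) hy01
  have h := abs_exp_neg_sub_exp_neg_le hms hm0 hθ hθ1
  refine h.trans (mul_le_mul_of_nonneg_left ?_ (Real.exp_pos _).le)
  exact Real.rpow_le_rpow (abs_nonneg _) (abs_esc_sub_esc_zero_le hs0 hs1 hA0 hrA hxs hys hx0 hy0) hθ.le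

/-- ★★ **UPPER POINTWISE BOUND**: `h_s ≤ h_0 + Δ₁` (`0 < s ≤ 1`, `0 < A ≤ 1`, `r² ≤ A`, `0 < θ ≤ 1`, both letters off the null set `{N_0 = 0}`).
[folklore] -/
theorem hsc_le_hsc_zero_add {s A r θ : ℝ} (hs0 : 0 < s) (hs1 : s ≤ 1) (hA0 : 0 < A) (hA1 : A ≤ 1) (hrA : r ^ 2 ≤ A)
    (hθ : 0 < θ) (hθ1 : θ ≤ 1) {x y : ℍ} (hx0 : 0 < x.re ^ 2 + x.imI ^ 2) (hy0 : 0 < y.re ^ 2 + y.imI ^ 2) :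
    hsc s A r x y ≤ hsc 0 A r x y + rateΔ₁ s θ r x y := by
  rw [hsc_def, hsc_def, rateΔ₁_def]
  by_cases hxs : nsc s x < 1
  swap
  · rw [indicator_of_notMem (show x ∉ {x : ℍ | nsc s x < 1} from hxs), zero_mul, zero_mul]; exact bot_le
  by_cases hys : nsc s y < 1
  swap
  · rw [indicator_of_notMem (show y ∉ {y : ℍ | nsc s y < 1} from hys), mul_zero, zero_mul]; exact bot_le
  have hx1 : x.re ^ 2 + x.imI ^ 2 < 1 := by have := nsc_mono hs0.le x; rw [nsc_zero] at this; linarith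
  have hy1 : y.re ^ 2 + y.imI ^ 2 < 1 := by have := nsc_mono hs0.le y; rw [nsc_zero] at this; linarith
  have hx1' : nsc 0 x < 1 := by rwa [nsc_zero]
  have hy1' : nsc 0 y < 1 := by rwa [nsc_zero]
  rw [indicator_of_mem (show x ∈ {x : ℍ | nsc s x < 1} from hxs), indicator_of_mem (show y ∈ {y : ℍ | nsc s y < 1} from hys),
    indicator_of_mem (show x ∈ {x : ℍ | nsc 0 x < 1} from hx1'), indicator_of_mem (show y ∈ {y : ℍ | nsc 0 y < 1} from hy1'),
    indicator_of_mem (show x ∈ {x : ℍ | x.re ^ 2 + x.imI ^ 2 < 1} from hx1),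
    indicator_of_mem (show y ∈ {y : ℍ | y.re ^ 2 + y.imI ^ 2 < 1} from hy1)]
  simp only [one_mul]
  have h := abs_exp_esc_sub_le hs0 hs1 hA0 hA1 hrA hθ hθ1 hxs hys hx0 hy0
  have hle : Real.exp (-(esc s A r x y)) ≤ Real.exp (-(esc 0 A r x y)) + Real.exp (-(gexp r x y)) * (s * rateR x y) ^ θ := by
    linarith [(abs_le.1 h).2]
  exact (ENNReal.ofReal_le_ofReal hle).trans ENNReal.ofReal_add_le

/-- ★★ **LOWER POINTWISE BOUND**: `h_0 ≤ h_s + Δ₁ + Δ₂` (same hypotheses). [folklore] -/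
theorem hsc_zero_le_hsc_add {s A r θ : ℝ} (hs0 : 0 < s) (hs1 : s ≤ 1) (hA0 : 0 < A) (hA1 : A ≤ 1) (hrA : r ^ 2 ≤ A)
    (hθ : 0 < θ) (hθ1 : θ ≤ 1) {x y : ℍ} (hx0 : 0 < x.re ^ 2 + x.imI ^ 2) (hy0 : 0 < y.re ^ 2 + y.imI ^ 2) :
    hsc 0 A r x y ≤ hsc s A r x y + rateΔ₁ s θ r x y + rateΔ₂ s r x y := by
  rw [hsc_def, hsc_def, rateΔ₁_def, rateΔ₂_def]
  by_cases hx1 : x.re ^ 2 + x.imI ^ 2 < 1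
  swap
  · rw [indicator_of_notMem (show x ∉ {x : ℍ | nsc 0 x < 1} by rw [mem_setOf_eq, nsc_zero]; exact hx1), zero_mul, zero_mul]
    exact bot_le
  by_cases hy1 : y.re ^ 2 + y.imI ^ 2 < 1
  swap
  · rw [indicator_of_notMem (show y ∉ {y : ℍ | nsc 0 y < 1} by rw [mem_setOf_eq, nsc_zero]; exact hy1), mul_zero, zero_mul]
    exact bot_le
  have hx1' : nsc 0 x < 1 := by rwa [nsc_zero]
  have hy1' : nsc 0 y < 1 := by rwa [nsc_zero]
  rw [indicator_of_mem (show x ∈ {x : ℍ | nsc 0 x < 1} from hx1'), indicator_of_mem (show y ∈ {y : ℍ | nsc 0 y < 1} from hy1'),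
    indicator_of_mem (show x ∈ {x : ℍ | x.re ^ 2 + x.imI ^ 2 < 1} from hx1),
    indicator_of_mem (show y ∈ {y : ℍ | y.re ^ 2 + y.imI ^ 2 < 1} from hy1)]
  simp only [one_mul, mul_one]
  -- the Gaussian floor at `s = 0`
  have hm0 : gexp r x y ≤ esc 0 A r x y :=
    gexp_le_esc le_rfl hA0 hA1 (by rwa [nsc_zero]) hx1'.le (by rwa [nsc_zero]) hy1'.le
  have hfloor : ENNReal.ofReal (Real.exp (-(esc 0 A r x y))) ≤ ENNReal.ofReal (Real.exp (-(gexp r x y))) :=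
    ENNReal.ofReal_le_ofReal (Real.exp_le_exp.2 (neg_le_neg hm0))
  by_cases hxs : nsc s x < 1
  · by_cases hys : nsc s y < 1
    · -- both inside: exponential difference
      rw [indicator_of_mem (show x ∈ {x : ℍ | nsc s x < 1} from hxs), indicator_of_mem (show y ∈ {y : ℍ | nsc s y < 1} from hys)]
      simp only [one_mul]
      have h := abs_exp_esc_sub_le hs0 hs1 hA0 hA1 hrA hθ hθ1 hxs hys hx0 hy0
      have hle : Real.exp (-(esc 0 A r x y)) ≤ Real.exp (-(esc s A r x y)) + Real.exp (-(gexp r x y)) * (s * rateR x y) ^ θ := by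
        linarith [(abs_le.1 h).1]
      exact ((ENNReal.ofReal_le_ofReal hle).trans ENNReal.ofReal_add_le).trans le_self_add
    · -- `y` in the layer
      have hyl : y ∈ layer s := by
        rw [mem_layer]; refine ⟨hy1, ?_⟩; rw [nsc_def] at hys; linarith
      rw [indicator_of_mem hyl]
      calc ENNReal.ofReal (Real.exp (-(esc 0 A r x y))) ≤ ENNReal.ofReal (Real.exp (-(gexp r x y))) := hfloor
        _ = 1 * ENNReal.ofReal (Real.exp (-(gexp r x y))) := (one_mul _).symm
        _ ≤ ((layer s).indicator (fun _ => (1 : ℝ≥0∞)) x + 1) * ENNReal.ofReal (Real.exp (-(gexp r x y))) :=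
            mul_le_mul' le_add_self le_rfl
        _ ≤ _ := le_add_self
  · -- `x` in the layer
    have hxl : x ∈ layer s := by
      rw [mem_layer]; refine ⟨hx1, ?_⟩; rw [nsc_def] at hxs; linarith
    rw [indicator_of_mem hxl]
    calc ENNReal.ofReal (Real.exp (-(esc 0 A r x y))) ≤ ENNReal.ofReal (Real.exp (-(gexp r x y))) := hfloor
      _ = 1 * ENNReal.ofReal (Real.exp (-(gexp r x y))) := (one_mul _).symm
      _ ≤ (1 + (layer s).indicator (fun _ => (1 : ℝ≥0∞)) y) * ENNReal.ofReal (Real.exp (-(gexp r x y))) :=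
          mul_le_mul' le_self_add le_rfl
      _ ≤ _ := le_add_self

end Summit.QuantumFields.YangMills.Theorems.SwapVirialDeficit.ZeroModeGroup

end
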